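import Summits.QuantumFields.BalabanUV.Beta.D1BFx.HodgeIdentityForms
import Summits.QuantumFields.BalabanUV.Beta.D1BFx.GluonLeg

/-!
# `BalabanUV.Beta.D1BFx.StencilKernels` — road «BF-x» for binder row D1, slot (K), X₁ brick Q2 «LOCAL STENCIL DICTIONARY an5 ↔ an2», FILE 3 (the `ℤ^d` side):
# the KERNELS of an2's local stencils — `lapKer` (`codiff₁∘dz`, pv23), `dzKer`, `codiffKer`, and the block-averaging kernel `qqKer n κ` of
# `contourSumAdj n ∘ contourSum n` — their row actions, translation ∕ block covariance (an4's `IsPeriodic₂`), finite support, and THE COMB LEMMA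
# «kernel row × indicator of a torus class = `periodise₂` entry»

WHY (`HOME/b2b-balaban-beta-d1-p2/X1-SPEC.md` v1 §1 brick Q2; owner `b2b-balaban-beta-d1-p2`, request journal l.19726 «state the an5-side ENTRIES through `siteOf`»).
FILE 2 (`StencilDictionaryTorus`) reads an5's torus operators on periodic lifts as an2's STENCILS; brick Q4 wants them as `ℤ^d` KERNELS `Δ^∞((x,κ),(w,l))` with summable
rows, jointly periodic under the block lattice (so that an4's `periodise₂` ∕ Q1's `periodiseF` and the unfold-and-regroup lemma apply), and FILE 4 turns «stencil on the lift
of a torus Kronecker delta» into «`periodise₂` entry».  THIS FILE supplies exactly those `ℤ^d`-side facts for the two LOCAL pieces of the (X₁a) operator (by FILE 1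
`HodgeIdentityForms` the vector part `½·curvAdj∘curv + dz∘codiff₁` is `codiff₁∘dz` componentwise, kernel `lapKer ⊗ δ_{κl}`; the averaging part `(a∕n⁸)·𝒬ᵀ𝒬` has kernel
`qqKer n κ ⊗ δ_{κl}`) and for the two LETTERS `dz`, `codiff₁` of the gauge sandwich (brick Q3c).

WHAT THIS FILE PROVES (all [folklore]; three [our object] kernel definitions `dzKer`, `codiffKer`, `qqKer` asserting nothing; any dimension `d`):
* §1 `lapKer`: **`codiff₁_dz_eq_tsum_lapKer`** (`codiff₁ (dz f) x = Σ'_w lapKer x w · f w`, every `f`, every `d` — `TowerEquationForms` has `d = 4`), `lapKer_translate`,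
  `isPeriodic₂_lapKer` (every `s`), `summable_lapKer_row`, `summable_abs_lapKer_row`.
* §2 `dzKer ν x w = 𝟙[w = x + e_ν] − 𝟙[w = x]`, `codiffKer κ x w = 𝟙[w = x − e_κ] − 𝟙[w = x]`: `dz_eq_tsum_dzKer`, `codiff₁_eq_sum_tsum_codiffKer`, `codiffKer_eq_dzKer_swap`
  (`codiff₁ = dzᵀ`), `…_translate`, `isPeriodic₂_dzKer` ∕ `isPeriodic₂_codiffKer`, `summable_dzKer_row` ∕ `summable_codiffKer_row`.
* §3 **`qqKer n κ x w := Σ_{s<n} Σ_{b ∈ box} Σ_{s′<n} 𝟙[w = n•blk n (x − s•e_κ) + toSite b + s′•e_κ]`** (multiplicity form): `sum_range_contourSum_blk` ∕ `contourSumAdj_contourSum_eq_sum`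
  (the floor form, `rfl`), **`contourSumAdj_contourSum_eq_tsum : contourSumAdj n (contourSum n A) κ x = Σ'_w qqKer n κ x w · A κ w`** (every `A`), `sum_box_ite_eq`
  (`Σ_{b∈box} 𝟙[w = n•y + toSite b] = 𝟙[blk n w = y]`), **`qqKer_eq_blockForm`** (`= Σ_{s,s′<n} 𝟙[blk n (w − s′•e_κ) = blk n (x − s•e_κ)]`, pv23's `sameBlk` along two contours),
  `qqKer_symm`, `blk_add_zsmul`, `qqKer_blockShift`, `imageShift_eq_add_zsmul`, **`isPeriodic₂_qqKer : IsPeriodic₂ n (qqKer n κ)`** (`1 ≤ n`), `qqKer_eq_zero_of_not_mem`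
  (finite support), `summable_qqKer_row`, `summable_abs_qqKer_row`, `qqKer_nonneg`.
* §4 `siteOf_eq_siteOf_iff` (`w̄ = z̄ ↔ ∃ m, w = imageShift s z m`), **`tsum_mul_comb_eq_periodise₂ : Σ'_w K x w · 𝟙[w̄ = z̄] = periodise₂ s K x̄ z̄`** (jointly `s`-periodic
  `K`, summable rows; `Function.Injective.tsum_eq` over the coset + an4's `periodise₂_eq_tsum_of_rep`), `tsum_comb_mul_eq_periodise₂`.

HONEST FRAMING (cell contract, verbatim): «discharging `BetaPertH` makes Bałaban's UV stability UNCONDITIONAL — a real constructive-QFT result; it is NOT the continuum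
limit and NOT the Clay problem.»  HONEST DEPENDENCY (verbatim): «continuum YM on T⁴ ⇐ BetaPertH ∧ nine spine estimates (0/9 proved); BetaPertH ⇐ (D1) ∧ (D4) ∧ CAP+tail;
G-an2-4 gates asym, D1 and NE2/3/4.»  [folklore] finite-support kernel bookkeeping on the cell's OWN typed stencils; no `Prop` is minted, nothing is cited, no wall binder is
instantiated; (X₁a) is NOT touched (Q4 assembles); 0 sorry.  NOT summit progress, NOT D1, NOT BetaPertH.
ABSOLUTE RULE (cell, verbatim): «No internally-minted statement may enter as a cited fact. Every hypothesis is either kernel-proved in this package or a verbatim quotation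
of a PUBLISHED theorem with page reference. The manuscript(s) under audit are NOT citable for their own disputed steps — they are the thing under adjudication;
programme-internal (2001/route/tribunal) claims are never citable.»
Provenance: G-an2-4 swarm leaf seat `b2b-balaban-gan24-formalise-leaf-06` gen 28 (prover-b2b-balaban-gan24-formalise-leaf-06-g28-0; cross-lane idle-seat duty G-an2-4 → D1,
road «BF-x», CLAIM «X1-Q2» journal l.19491; FILE 1 `HodgeIdentityForms` p232119, FILE 2 `StencilDictionaryTorus` p232616), 2026-08-20.
-/

namespace Summit.QuantumFields.BalabanUV.Beta.D1BFx.StencilKernels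

open Literature.MathematicalPhysics.QuantumFieldTheory.Balaban1983to89
open Literature.MathematicalPhysics.QuantumFieldTheory.Balaban1983to89.Beta
open AffineAveraging (Site Form0 Form1 unitVec dz codiff₁ box toSite contourSum)
open AffineReproduction (contourSumAdj)
open AveragingContours (blk off blk_add_off off_mem_box blk_block)
open B6QGQLower276 (lapKer lapDir)
open B5Hk103ScalarZd (nbhd tsum_lapKer_mul lapKer_eq_zero_of_not_mem)

noncomputable section

variable {d : ℕ}

/-! ## §1 The positive Laplacian kernel `lapKer` (pv23): row action on 0-forms, translation invariance, periodicity, summable rows -/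

/-- [folklore] **`codiff₁ ∘ dz` IS THE ROW ACTION OF `lapKer`, ANY DIMENSION**: `codiff₁ (dz f) x = Σ'_w lapKer x w · f w` for EVERY `f`
(`B5Hk103ScalarZd.tsum_lapKer_mul`; `TowerEquationForms.codiff₁_dz_eq_tsum_lapKer` is the `d = 4` instance). -/
theorem codiff₁_dz_eq_tsum_lapKer (f : Form0 d ℝ) (x : Site d) :
    codiff₁ (dz f) x = ∑' w : Site d, lapKer x w * f w := by
  rw [tsum_lapKer_mul]
  simp only [codiff₁, dz, sub_add_cancel]
  refine Finset.sum_congr rfl fun μ _ => ?_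
  show f x - f (x - unitVec μ) - (f (x + unitVec μ) - f x) = 2 * f x - f (x + unitVec μ) - f (x - unitVec μ)
  ring

/-- [folklore] `lapKer` is translation invariant: `lapKer (x + v) (w + v) = lapKer x w`. -/
theorem lapKer_translate (x w v : Site d) : lapKer (x + v) (w + v) = lapKer x w := by
  simp only [lapKer, lapDir]
  refine Finset.sum_congr rfl fun μ _ => ?_
  have h1 : (w + v = x + v) ↔ (w = x) := add_left_inj v
  have h2 : (w + v = x + v + B6QGQLower276.e μ) ↔ (w = x + B6QGQLower276.e μ) := by
    rw [add_right_comm, add_left_inj]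
  have h3 : (w + v = x + v - B6QGQLower276.e μ) ↔ (w = x - B6QGQLower276.e μ) := by
    rw [sub_eq_add_neg, add_right_comm, ← sub_eq_add_neg, add_left_inj]
  simp only [h1, h2, h3]

/-- [folklore] `lapKer` is jointly `s`-periodic for every `s` (translation invariance). -/
theorem isPeriodic₂_lapKer (s : ℕ) : IsPeriodic₂ s (lapKer (d := d)) :=
  IsPeriodic₂.of_transInv (fun x y v => lapKer_translate x y v) s

/-- [folklore] The rows of `lapKer` vanish off the finite set `nbhd 0 x`, hence are summable. -/
theorem summable_lapKer_row (x : Site d) : Summable (lapKer x) :=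
  summable_of_ne_finset_zero (s := nbhd 0 x) fun _ hw => lapKer_eq_zero_of_not_mem (n := 0) hw

/-- [folklore] … and absolutely summable. -/
theorem summable_abs_lapKer_row (x : Site d) : Summable fun w => |lapKer x w| :=
  (summable_lapKer_row x).abs

/-! ## §2 The gradient and codifferential kernels `dzKer`, `codiffKer` -/

/-- [our object] The kernel of an2's `dz` in direction `ν`: `dzKer ν x w = 𝟙[w = x + e_ν] − 𝟙[w = x]`. -/
def dzKer (ν : Fin d) : Kernel₂ d := fun x w => (if w = x + unitVec ν then 1 else 0) - (if w = x then 1 else 0)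

/-- [our object] The kernel of the `κ`-th summand of an2's `codiff₁`: `codiffKer κ x w = 𝟙[w = x − e_κ] − 𝟙[w = x]`. -/
def codiffKer (κ : Fin d) : Kernel₂ d := fun x w => (if w = x - unitVec κ then 1 else 0) - (if w = x then 1 else 0)

/-- [folklore] `dz` is the row action of `dzKer`: `dz f ν x = Σ'_w dzKer ν x w · f w` (two non-zero terms). -/
theorem dz_eq_tsum_dzKer (f : Form0 d ℝ) (ν : Fin d) (x : Site d) :
    dz f ν x = ∑' w : Site d, dzKer ν x w * f w := by
  have h1 : Summable fun w : Site d => (if w = x + unitVec ν then (1 : ℝ) else 0) * f w :=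
    summable_of_ne_finset_zero (s := {x + unitVec ν}) fun w hw => by
      rw [Finset.mem_singleton] at hw; rw [if_neg hw, zero_mul]
  have h2 : Summable fun w : Site d => (if w = x then (1 : ℝ) else 0) * f w :=
    summable_of_ne_finset_zero (s := {x}) fun w hw => by
      rw [Finset.mem_singleton] at hw; rw [if_neg hw, zero_mul]
  simp only [dzKer, sub_mul]
  rw [h1.tsum_sub h2]
  simp only [ite_mul, one_mul, zero_mul, tsum_ite_eq]
  rfl

/-- [folklore] `codiff₁` is the sum over directions of the row actions of `codiffKer`: `codiff₁ A x = Σ_κ Σ'_w codiffKer κ x w · A κ w`. -/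
theorem codiff₁_eq_sum_tsum_codiffKer (A : Form1 d ℝ) (x : Site d) :
    codiff₁ A x = ∑ κ, ∑' w : Site d, codiffKer κ x w * A κ w := by
  simp only [codiff₁]
  refine Finset.sum_congr rfl fun κ _ => ?_
  have h1 : Summable fun w : Site d => (if w = x - unitVec κ then (1 : ℝ) else 0) * A κ w :=
    summable_of_ne_finset_zero (s := {x - unitVec κ}) fun w hw => by
      rw [Finset.mem_singleton] at hw; rw [if_neg hw, zero_mul]
  have h2 : Summable fun w : Site d => (if w = x then (1 : ℝ) else 0) * A κ w :=
    summable_of_ne_finset_zero (s := {x}) fun w hw => by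
      rw [Finset.mem_singleton] at hw; rw [if_neg hw, zero_mul]
  simp only [codiffKer, sub_mul]
  rw [h1.tsum_sub h2]
  simp only [ite_mul, one_mul, zero_mul, tsum_ite_eq]

/-- [folklore] `codiffKer` is the TRANSPOSE of `dzKer`: `codiffKer κ x w = dzKer κ w x` (`codiff₁ = dzᵀ`). -/
theorem codiffKer_eq_dzKer_swap (κ : Fin d) (x w : Site d) : codiffKer κ x w = dzKer κ w x := by
  simp only [codiffKer, dzKer]
  have h1 : (w = x - unitVec κ) ↔ (x = w + unitVec κ) := by
    constructor
    · intro h; rw [h, sub_add_cancel]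
    · intro h; rw [h, add_sub_cancel_right]
  have h2 : (w = x) ↔ (x = w) := eq_comm
  simp only [h1, h2]

/-- [folklore] `dzKer` is translation invariant. -/
theorem dzKer_translate (ν : Fin d) (x w v : Site d) : dzKer ν (x + v) (w + v) = dzKer ν x w := by
  simp only [dzKer]
  have h1 : (w + v = x + v + unitVec ν) ↔ (w = x + unitVec ν) := by rw [add_right_comm, add_left_inj]
  have h2 : (w + v = x + v) ↔ (w = x) := add_left_inj v
  simp only [h1, h2]

/-- [folklore] `codiffKer` is translation invariant. -/
theorem codiffKer_translate (κ : Fin d) (x w v : Site d) : codiffKer κ (x + v) (w + v) = codiffKer κ x w := by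
  rw [codiffKer_eq_dzKer_swap, codiffKer_eq_dzKer_swap, dzKer_translate]

/-- [folklore] `dzKer ν` is jointly `s`-periodic for every `s`. -/
theorem isPeriodic₂_dzKer (ν : Fin d) (s : ℕ) : IsPeriodic₂ s (dzKer (d := d) ν) :=
  IsPeriodic₂.of_transInv (fun x y v => dzKer_translate ν x y v) s

/-- [folklore] `codiffKer κ` is jointly `s`-periodic for every `s`. -/
theorem isPeriodic₂_codiffKer (κ : Fin d) (s : ℕ) : IsPeriodic₂ s (codiffKer (d := d) κ) :=
  IsPeriodic₂.of_transInv (fun x y v => codiffKer_translate κ x y v) s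

/-- [folklore] Rows of `dzKer` are finitely supported, hence summable. -/
theorem summable_dzKer_row (ν : Fin d) (x : Site d) : Summable (dzKer ν x) :=
  summable_of_ne_finset_zero (s := {x + unitVec ν, x}) fun w hw => by
    simp only [Finset.mem_insert, Finset.mem_singleton, not_or] at hw
    simp only [dzKer, if_neg hw.1, if_neg hw.2, sub_zero]

/-- [folklore] Rows of `codiffKer` are finitely supported, hence summable. -/
theorem summable_codiffKer_row (κ : Fin d) (x : Site d) : Summable (codiffKer κ x) :=
  summable_of_ne_finset_zero (s := {x - unitVec κ, x}) fun w hw => by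
    simp only [Finset.mem_insert, Finset.mem_singleton, not_or] at hw
    simp only [codiffKer, if_neg hw.1, if_neg hw.2, sub_zero]

/-! ## §3 The block-averaging kernel `qqKer n κ` of `contourSumAdj n ∘ contourSum n` -/

/-- [our object] THE KERNEL OF `𝒬ᵀ𝒬 = contourSumAdj n ∘ contourSum n` ON THE COMPONENT `κ` (multiplicity form): `qqKer n κ x w` = the number of
triples `(s, b, s′) ∈ {0..n−1} × {0..n−1}^d × {0..n−1}` with `w = n • blk n (x − s•e_κ) + toSite b + s′•e_κ` — the straight contour of `n` bonds in
direction `κ` through `x` meets the block `blk n (x − s•e_κ)`, whose `n^d` contours of `n` bonds are summed. -/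
def qqKer (n : ℕ) (κ : Fin d) : Kernel₂ d := fun x w =>
  ∑ s ∈ Finset.range n, ∑ b ∈ box d n, ∑ s' ∈ Finset.range n,
    if w = (n : ℤ) • blk n (x - (s : ℤ) • unitVec κ) + toSite b + (s' : ℤ) • unitVec κ then 1 else 0

/-- [folklore] The floor form of `𝒬ᵀ𝒬` unfolded (any ring): `Σ_{s<n} (contourSum n A)_κ(blk n (x − s•e_κ)) = Σ_{s} Σ_{b} Σ_{s′} A_κ(n•blk n (x − s•e_κ) + toSite b + s′•e_κ)`. -/
theorem sum_range_contourSum_blk {R : Type*} [CommRing R] (n : ℕ) (A : Form1 d R) (κ : Fin d) (x : Site d) :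
    ∑ s ∈ Finset.range n, contourSum n A κ (blk n (x - (s : ℤ) • unitVec κ))
      = ∑ s ∈ Finset.range n, ∑ b ∈ box d n, ∑ s' ∈ Finset.range n,
          A κ ((n : ℤ) • blk n (x - (s : ℤ) • unitVec κ) + toSite b + (s' : ℤ) • unitVec κ) := rfl

/-- [folklore] an2's `contourSumAdj n (contourSum n A)` IS that floor-form sum (its floor quotient is `AveragingContours.blk`). -/
theorem contourSumAdj_contourSum_eq_sum (n : ℕ) (A : Form1 d ℝ) (κ : Fin d) (x : Site d) :
    contourSumAdj n (contourSum n A) κ x = ∑ s ∈ Finset.range n, contourSum n A κ (blk n (x - (s : ℤ) • unitVec κ)) := rfl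

/-- [folklore] **`𝒬ᵀ𝒬` IS THE ROW ACTION OF `qqKer`**: `contourSumAdj n (contourSum n A) κ x = Σ'_w qqKer n κ x w · A κ w` for EVERY 1-form `A`
(finitely many non-zero terms). -/
theorem contourSumAdj_contourSum_eq_tsum (n : ℕ) (A : Form1 d ℝ) (κ : Fin d) (x : Site d) :
    contourSumAdj n (contourSum n A) κ x = ∑' w : Site d, qqKer n κ x w * A κ w := by
  rw [contourSumAdj_contourSum_eq_sum, sum_range_contourSum_blk]
  simp only [qqKer, Finset.sum_mul, ite_mul, one_mul, zero_mul]
  have hsingle : ∀ p : Site d, Summable fun w : Site d => if w = p then A κ w else 0 := fun p =>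
    summable_of_ne_finset_zero (s := {p}) fun w hw => by
      rw [Finset.mem_singleton] at hw; rw [if_neg hw]
  rw [Summable.tsum_finsetSum fun s _ => summable_sum fun b _ => summable_sum fun s' _ => hsingle _]
  refine Finset.sum_congr rfl fun s _ => ?_
  rw [Summable.tsum_finsetSum fun b _ => summable_sum fun s' _ => hsingle _]
  refine Finset.sum_congr rfl fun b _ => ?_
  rw [Summable.tsum_finsetSum fun s' _ => hsingle _]
  refine Finset.sum_congr rfl fun s' _ => ?_
  rw [tsum_ite_eq]

/-- [folklore] BLOCK MEMBERSHIP AS A BOX SUM: `Σ_{b ∈ box} 𝟙[w = n•y + toSite b] = 𝟙[blk n w = y]` (`1 ≤ n`; `AveragingContours.blk_block` ∕ `blk_add_off`). -/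
theorem sum_box_ite_eq (n : ℕ) (hn : 1 ≤ n) (y w : Site d) :
    (∑ b ∈ box d n, if w = (n : ℤ) • y + toSite b then (1 : ℝ) else 0) = if blk n w = y then 1 else 0 := by
  by_cases h : blk n w = y
  · rw [if_pos h]
    have hw : w = (n : ℤ) • y + toSite (off n w) := by rw [← h]; exact (blk_add_off hn w).symm
    rw [Finset.sum_eq_single (off n w)]
    · rw [if_pos hw]
    · intro b hb hne
      rw [if_neg]
      intro hw'
      apply hne
      have e : toSite b = toSite (off n w) := by
        have := hw'.symm.trans hw
        exact add_left_cancel this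
      funext i
      have ei := congrFun e i
      simp only [toSite] at ei
      exact_mod_cast ei
    · intro hoff
      exact absurd (off_mem_box hn w) hoff
  · rw [if_neg h]
    refine Finset.sum_eq_zero fun b hb => ?_
    rw [if_neg]
    intro hw
    exact h (by rw [hw]; exact blk_block y hb)

/-- [folklore] **BLOCK FORM of `qqKer`**: `qqKer n κ x w = Σ_{s<n} Σ_{s′<n} 𝟙[blk n (w − s′•e_κ) = blk n (x − s•e_κ)]` (`1 ≤ n`) — in pv23's words a
double contour sum of `sameBlk` indicators. -/
theorem qqKer_eq_blockForm (n : ℕ) (hn : 1 ≤ n) (κ : Fin d) (x w : Site d) :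
    qqKer n κ x w = ∑ s ∈ Finset.range n, ∑ s' ∈ Finset.range n,
      if blk n (w - (s' : ℤ) • unitVec κ) = blk n (x - (s : ℤ) • unitVec κ) then (1 : ℝ) else 0 := by
  simp only [qqKer]
  refine Finset.sum_congr rfl fun s _ => ?_
  rw [Finset.sum_comm]
  refine Finset.sum_congr rfl fun s' _ => ?_
  rw [← sum_box_ite_eq n hn]
  refine Finset.sum_congr rfl fun b _ => ?_
  have e : (w = (n : ℤ) • blk n (x - (s : ℤ) • unitVec κ) + toSite b + (s' : ℤ) • unitVec κ)
      ↔ (w - (s' : ℤ) • unitVec κ = (n : ℤ) • blk n (x - (s : ℤ) • unitVec κ) + toSite b) := by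
    constructor
    · intro h; rw [h, add_sub_cancel_right]
    · intro h; rw [← h, sub_add_cancel]
  simp only [e]

/-- [folklore] `qqKer n κ` is SYMMETRIC (`𝒬ᵀ𝒬` is self-adjoint). -/
theorem qqKer_symm (n : ℕ) (hn : 1 ≤ n) (κ : Fin d) (x w : Site d) : qqKer n κ x w = qqKer n κ w x := by
  rw [qqKer_eq_blockForm n hn, qqKer_eq_blockForm n hn, Finset.sum_comm]
  refine Finset.sum_congr rfl fun s _ => Finset.sum_congr rfl fun s' _ => ?_
  simp only [eq_comm]

/-- [folklore] The floor quotient is block-translation covariant: `blk n (y + n•t) = blk n y + t` (`1 ≤ n`). -/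
theorem blk_add_zsmul (n : ℕ) (hn : 1 ≤ n) (y t : Site d) : blk n (y + (n : ℤ) • t) = blk n y + t := by
  funext i
  have hn0 : (n : ℤ) ≠ 0 := by exact_mod_cast (Nat.one_le_iff_ne_zero.mp hn)
  simp only [blk, Pi.add_apply, Pi.smul_apply, smul_eq_mul]
  rw [Int.add_mul_ediv_left _ _ hn0]

/-- [folklore] `qqKer n κ` is BLOCK-TRANSLATION COVARIANT: `qqKer n κ (x + n•t) (w + n•t) = qqKer n κ x w` (`1 ≤ n`). -/
theorem qqKer_blockShift (n : ℕ) (hn : 1 ≤ n) (κ : Fin d) (x w t : Site d) :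
    qqKer n κ (x + (n : ℤ) • t) (w + (n : ℤ) • t) = qqKer n κ x w := by
  rw [qqKer_eq_blockForm n hn, qqKer_eq_blockForm n hn]
  refine Finset.sum_congr rfl fun s _ => Finset.sum_congr rfl fun s' _ => ?_
  have e1 : w + (n : ℤ) • t - (s' : ℤ) • unitVec κ = (w - (s' : ℤ) • unitVec κ) + (n : ℤ) • t := by abel
  have e2 : x + (n : ℤ) • t - (s : ℤ) • unitVec κ = (x - (s : ℤ) • unitVec κ) + (n : ℤ) • t := by abel
  rw [e1, e2, blk_add_zsmul n hn, blk_add_zsmul n hn]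
  simp only [add_left_inj]

/-- [folklore] `imageShift n x m = x + n • m`. -/
theorem imageShift_eq_add_zsmul (n : ℕ) (x m : Site d) : imageShift n x m = x + (n : ℤ) • m := by
  funext i
  simp [imageShift]

/-- [folklore] **`qqKer n κ` IS JOINTLY `n`-PERIODIC** (an4's `IsPeriodic₂`), hence `s`-periodic for every multiple `s` of `n` (`IsPeriodic₂.of_dvd`). -/
theorem isPeriodic₂_qqKer (n : ℕ) (hn : 1 ≤ n) (κ : Fin d) : IsPeriodic₂ n (qqKer n κ) := by
  intro x w m
  rw [imageShift_eq_add_zsmul, imageShift_eq_add_zsmul, qqKer_blockShift n hn]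

/-- [folklore] The row `qqKer n κ x ·` is supported in the finite set of contour points. -/
theorem qqKer_eq_zero_of_not_mem (n : ℕ) (κ : Fin d) (x w : Site d)
    (hw : w ∉ ((Finset.range n ×ˢ box d n) ×ˢ Finset.range n).image
      (fun t : (ℕ × (Fin d → ℕ)) × ℕ => (n : ℤ) • blk n (x - (t.1.1 : ℤ) • unitVec κ) + toSite t.1.2 + (t.2 : ℤ) • unitVec κ)) :
    qqKer n κ x w = 0 := by
  simp only [qqKer]
  refine Finset.sum_eq_zero fun s hs => Finset.sum_eq_zero fun b hb => Finset.sum_eq_zero fun s' hs' => ?_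
  rw [if_neg]
  intro h
  apply hw
  rw [Finset.mem_image]
  exact ⟨((s, b), s'), by simp [hs, hb, hs'], h.symm⟩

/-- [folklore] Rows of `qqKer` are summable (finite support). -/
theorem summable_qqKer_row (n : ℕ) (κ : Fin d) (x : Site d) : Summable (qqKer n κ x) :=
  summable_of_ne_finset_zero fun w hw => qqKer_eq_zero_of_not_mem n κ x w hw

/-- [folklore] … and absolutely summable. -/
theorem summable_abs_qqKer_row (n : ℕ) (κ : Fin d) (x : Site d) : Summable fun w => |qqKer n κ x w| :=
  (summable_qqKer_row n κ x).abs

/-- [folklore] `qqKer` is non-negative (a count). -/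
theorem qqKer_nonneg (n : ℕ) (κ : Fin d) (x w : Site d) : 0 ≤ qqKer n κ x w :=
  Finset.sum_nonneg fun _ _ => Finset.sum_nonneg fun _ _ => Finset.sum_nonneg fun _ _ => by split_ifs <;> norm_num

/-! ## §4 The Kronecker comb: a kernel row against the indicator of a torus class IS the periodised entry (an4's `periodise₂`) -/

section Comb

variable {s : ℕ} [NeZero s]

omit [NeZero s] in
/-- [folklore] Two lattice points have the same reduction on the cubic torus `(ℤ∕s)^d` iff they differ by an image shift `s • m`. -/
theorem siteOf_eq_siteOf_iff (w z : Site d) : siteOf d s w = siteOf d s z ↔ ∃ m : Site d, w = imageShift s z m := by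
  constructor
  · intro h
    have hc : ∀ i, ∃ k : ℤ, w i = z i + (s : ℤ) * k := by
      intro i
      have hi : ((w i : ℤ) : ZMod s) = ((z i : ℤ) : ZMod s) := congrFun h i
      obtain ⟨k, hk⟩ := (ZMod.intCast_eq_intCast_iff_dvd_sub _ _ _).mp hi
      exact ⟨-k, by linarith⟩
    choose m hm using hc
    exact ⟨m, funext fun i => by rw [imageShift_apply]; exact hm i⟩
  · rintro ⟨m, rfl⟩
    exact siteOf_imageShift z m

/-- [folklore] **THE COMB LEMMA**: for a jointly `s`-periodic kernel `K` with summable rows, the row `K x ·` summed against the indicator of the torus class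
of `z` IS the periodised entry: `Σ'_w K x w · 𝟙[w̄ = z̄] = periodise₂ s K x̄ z̄` (injective re-indexing of the `tsum` over the coset `z + s•ℤ^d`, then an4's
`periodise₂_eq_tsum_of_rep`).  This is how a TORUS MATRIX ENTRY of a local operator — its action on a torus Kronecker delta, whose lift to `ℤ^d` is the
comb — becomes a `periodise₂` entry. -/
theorem tsum_mul_comb_eq_periodise₂ {K : Kernel₂ d} (hper : IsPeriodic₂ s K) (hrow : ∀ x, Summable (K x)) (x z : Site d) :
    ∑' w : Site d, K x w * (if siteOf d s w = siteOf d s z then (1 : ℝ) else 0) = periodise₂ s K (siteOf d s x) (siteOf d s z) := by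
  rw [periodise₂_eq_tsum_of_rep hper hrow (rfl : siteOf d s x = siteOf d s x) (rfl : siteOf d s z = siteOf d s z)]
  have hinj := imageShift_injective s z
  have hsupp : Function.support (fun w : Site d => K x w * (if siteOf d s w = siteOf d s z then (1 : ℝ) else 0))
      ⊆ Set.range (imageShift s z) := by
    intro w hw
    rw [Function.mem_support] at hw
    have hwz : siteOf d s w = siteOf d s z := by
      by_contra h
      rw [if_neg h, mul_zero] at hw
      exact hw rfl
    obtain ⟨m, hm⟩ := (siteOf_eq_siteOf_iff w z).1 hwz
    exact ⟨m, hm.symm⟩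
  rw [← hinj.tsum_eq hsupp]
  refine tsum_congr fun m => ?_
  simp only [siteOf_imageShift, if_true, mul_one]

/-- [folklore] The comb lemma with the indicator on the left factor. -/
theorem tsum_comb_mul_eq_periodise₂ {K : Kernel₂ d} (hper : IsPeriodic₂ s K) (hrow : ∀ x, Summable (K x)) (x z : Site d) :
    ∑' w : Site d, (if siteOf d s w = siteOf d s z then (1 : ℝ) else 0) * K x w = periodise₂ s K (siteOf d s x) (siteOf d s z) := by
  rw [← tsum_mul_comb_eq_periodise₂ hper hrow x z]
  exact tsum_congr fun w => mul_comm _ _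

end Comb

end

end Summit.QuantumFields.BalabanUV.Beta.D1BFx.StencilKernels
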